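import Literature.AnabelianGeometry.EtaleTheta.ContH1ContinuousCohomology
import Literature.NumberTheory.GaloisRepresentations.GaloisCohomologyInfResProofs
import HarnessLib

/-!
# [EtTh] §1 support: inflation–restriction in degree one for `ContH1`
# (`Ker(H¹(H, A) → H¹(N, A)) ≅ H¹(H/N, A)` when `N ⊴ H` acts trivially on `A`)

Support file of the abc-iut cell (layer L2, [EtTh]; seat abc-iut-L2-t12, unit W2-L2-08 (d)). [EtTh]
Prop. 1.5 (i)/(ii) (PRIMS PDF p. 23) reads the second step of "the natural filtration
`0 ⊆ F² ⊆ F¹ ⊆ F⁰ = H¹((Π^tp_Y)^Θ, Δ_Θ)`" as "`F² = H¹(G_K, Δ_Θ)`", i.e. identifies the kernel of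
restriction to `(Δ^tp_Y)^Θ` with the cohomology of the quotient `(Π^tp_Y)^Θ/(Δ^tp_Y)^Θ = G_K`
[cite: MochizukiEtTh2009, Prop 1.5 p.23] — the degree-one inflation–restriction sequence
`0 → H¹(H/N, A^N) → H¹(H, A) → H¹(N, A)` [cite: NeukirchSchmidtWingberg2008, I §2 and II §7] for
`N = (Δ^tp_Y)^Θ ⊴ H = (Π^tp_Y)^Θ`, which acts trivially on `A = Δ_Θ` (`Δ_Θ` is central in
`(Δ^tp_X)^Θ`, p. 12). abc-iut-L2-t1 typed `F²` as that kernel (`ThetaCohomology.F2`); the carrier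
`ContH1` (crossed homomorphisms into a normal subgroup `A ≤ G'`, action by conjugation through
`φ : G →* G'`) has no "coefficients of a quotient group", so the right-hand side was not expressible.

This file supplies it, GENERICALLY, through the bridge `ContH1 ≃* continuousCohomology 1`
(`ContH1ContinuousCohomology.lean`) and the tree's inflation–restriction theorem for Mathlib's
continuous cohomology (`Literature.NumberTheory.GaloisRepresentations.ContinuousCohomology.exact_inf_res_one`):
for `N ≤ H ≤ G` with `N` normal in `H` and acting trivially on `A` through `φ`,

* `quotConjContRep` / `quotConjTopRep φ A hNH htriv : TopRep ℤ (↥H ⧸ N.subgroupOf H)` — the quotient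
  `H/N` acting on `Additive ↥A` by conjugation through `φ` (well defined by triviality on `N`);
  `quotResHom` — the compatible pair (quotient map, identity) back to `conjTopRep φ A H`;
* `ContH1.inflOfQuotient : Multiplicative (continuousCohomology 1 (quotConjTopRep …)) →* ContH1 φ A H`
  — INFLATION from the quotient, `[c] ↦ [c ∘ (H → H/N)]`;
* `ContH1.inflOfQuotient_injective` — injective (degree one);
* `ContH1.range_inflOfQuotient_eq_ker_res` — **its range is exactly the kernel of restriction**
  `ContH1.res φ A hNH : ContH1 φ A H → ContH1 φ A N`; packaged as the group isomorphism
  `ContH1.kerResEquivQuotient : (ContH1.res φ A hNH).ker ≃* Multiplicative (continuousCohomology 1 _)`.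

The [EtTh] instances (`F²`, `F̈²` of Prop. 1.5 (i), (ii)) are in `ThetaCohomologyInfRes.lean`.
Hypotheses beyond `ContH1.lean`'s: `G G' : Type u` (one universe, forced by Mathlib's cochains) and
`Continuous φ` (continuity of the orbit maps `g ↦ φ(g) a φ(g)⁻¹`). Generic homological algebra; no
anabelian content; nothing of [EtTh] is asserted.
-/

noncomputable section

namespace Literature.AnabelianGeometry.EtaleTheta

open CategoryTheory TopRep ContRepresentation Literature.NumberTheory.GaloisRepresentations
open scoped IsMulCommutative

universe u

section InfRes

variable {G G' : Type u} [Group G] [Group G'] [TopologicalSpace G'] [IsTopologicalGroup G']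
  (φ : G →* G') (A : Subgroup G') [A.Normal] [IsMulCommutative A]
  (H : Subgroup G) {N : Subgroup G} (hNH : N ≤ H) [hn : (N.subgroupOf H).Normal]
  (htriv : ∀ n ∈ N, ∀ a : A, MulAut.conjNormal (φ n) a = a)

/-! ### The quotient `H/N` acting on `A` -/

omit hn in
include htriv in
/-- `N` acts trivially through `φ`: the conjugation representation of `H` kills `N.subgroupOf H`.
[cite: NeukirchSchmidtWingberg2008, I §2 and II §7] -/
theorem subgroupOf_le_ker_conjContRep :
    N.subgroupOf H ≤ (conjContRep φ A H).toMonoidHom.ker := by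
  intro x hx
  rw [MonoidHom.mem_ker]
  refine ContinuousLinearMap.ext fun a => ?_
  change conjCLM A (φ ((x : H) : G)) a = a
  rw [conjCLM_apply, htriv _ (Subgroup.mem_subgroupOf.1 hx)]
  rfl

/-- The continuous `ℤ`-linear representation of the quotient `H/N` on `Additive ↥A`: the class of
`h` acts by conjugation by `φ h` (well defined since `N` acts trivially).
[cite: NeukirchSchmidtWingberg2008, I §2 and II §7] -/
def quotConjContRep : ContRepresentation ℤ (H ⧸ N.subgroupOf H) (Additive A) :=
  ContRepresentation.ofMonoidHom
    (QuotientGroup.lift (N.subgroupOf H) (conjContRep φ A H).toMonoidHom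
      (subgroupOf_le_ker_conjContRep φ A H htriv))

/-- The coefficient module `Additive ↥A` as an object of `TopRep ℤ (H/N)` ("`A^N = A`", the
coefficients of `H¹(H/N, A^N)`). [cite: NeukirchSchmidtWingberg2008, I §2 and II §7] -/
abbrev quotConjTopRep : TopRep.{u} ℤ (H ⧸ N.subgroupOf H) :=
  TopRep.of (quotConjContRep φ A H htriv)

/-- The action of the class of `h ∈ H` on `quotConjTopRep` is conjugation by `φ h`.
[cite: NeukirchSchmidtWingberg2008, I §2 and II §7] -/
@[simp] theorem quotConjTopRep_ρ_mk (h : H) (a : Additive A) :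
    (quotConjTopRep φ A H htriv).ρ (QuotientGroup.mk h) a =
      Additive.ofMul (α := A) (MulAut.conjNormal (φ (h : G)) (Additive.toMul (α := A) a)) :=
  rfl

variable [TopologicalSpace G]

/-- The compatible pair for inflation: along the quotient map `H → H/N`, the identity of
`Additive ↥A` is a morphism `res (H → H/N) (quotConjTopRep) ⟶ conjTopRep φ A H`.
[cite: NeukirchSchmidtWingberg2008, I §2 and II §7] -/
def quotResHom :
    TopRep.res (ContinuousMonoidHom.quotientMk (N.subgroupOf H) : H →* H ⧸ N.subgroupOf H)
      (quotConjTopRep φ A H htriv) ⟶ conjTopRep φ A H :=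
  TopRep.ofHom
    { toLinearMap := LinearMap.id
      cont := continuous_id
      isIntertwining' := fun x => by ext a; rfl }

/-- `quotResHom` is the identity on elements. [cite: NeukirchSchmidtWingberg2008, I §2 and II §7] -/
@[simp] theorem quotResHom_apply (a : Additive A) : (quotResHom φ A H htriv).hom a = a := rfl

/-! ### Inflation from the quotient into `ContH1` -/

variable [IsTopologicalGroup G]

/-- **Inflation** `H¹(H/N, A) → H¹(H, A) = ContH1 φ A H`: Mathlib's `ContinuousCohomology.map` of the
pair (`H → H/N`, identity), read in `ContH1` through `ContH1.continuousCohomologyEquiv`.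
[cite: NeukirchSchmidtWingberg2008, I §2 and II §7] -/
def ContH1.inflOfQuotient :
    Multiplicative (continuousCohomology 1 (quotConjTopRep φ A H htriv)) →* ContH1 φ A H :=
  (ContH1.continuousCohomologyEquiv φ A H).symm.toMonoidHom.comp
    (AddMonoidHom.toMultiplicative
      (ContinuousCohomology.map (ContinuousMonoidHom.quotientMk (N.subgroupOf H))
        (quotResHom φ A H htriv) 1).hom.toLinearMap.toAddMonoidHom)

/-- `inflOfQuotient` followed by the comparison map is Mathlib's inflation.
[cite: NeukirchSchmidtWingberg2008, I §2 and II §7] -/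
theorem ContH1.toContinuousCohomology_inflOfQuotient
    (y : Multiplicative (continuousCohomology 1 (quotConjTopRep φ A H htriv))) :
    ContH1.toContinuousCohomology φ A H (ContH1.inflOfQuotient φ A H htriv y) = Multiplicative.ofAdd
      (ContinuousCohomology.map (ContinuousMonoidHom.quotientMk (N.subgroupOf H))
        (quotResHom φ A H htriv) 1 (Multiplicative.toAdd y)) := by
  change ContH1.continuousCohomologyEquiv φ A H ((ContH1.continuousCohomologyEquiv φ A H).symm _) = _
  rw [MulEquiv.apply_symm_apply]
  rfl

/-- On the class of a continuous crossed homomorphism `c : H/N → A`, `inflOfQuotient` is the class of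
`c ∘ (H → H/N)`. [cite: NeukirchSchmidtWingberg2008, I §2 and II §7] -/
theorem ContH1.inflOfQuotient_oneCocycleClass (c : contOneCocycles (quotConjTopRep φ A H htriv)) :
    ContH1.inflOfQuotient φ A H htriv (Multiplicative.ofAdd (oneCocycleClass _ c)) =
      ContH1.mk (fun h : H => Additive.toMul (α := A) (c.1 (QuotientGroup.mk h)))
        (ofContOneCocycle φ A H (contOneCocycles.pullback
          (ContinuousMonoidHom.quotientMk (N.subgroupOf H)) (quotResHom φ A H htriv) c)).2 := by
  apply ContH1.toContinuousCohomology_injective φ A H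
  rw [ContH1.toContinuousCohomology_inflOfQuotient, toAdd_ofAdd, map_oneCocycleClass,
    ContH1.toContinuousCohomology_mk]
  rfl

variable (hφ : Continuous φ)

/-- **Inflation is injective in degree one.** [cite: NeukirchSchmidtWingberg2008, I §2 and II §7] -/
theorem ContH1.inflOfQuotient_injective :
    Function.Injective (ContH1.inflOfQuotient φ A H htriv) := by
  refine (injective_iff_map_eq_one _).2 fun y hy => ?_
  obtain ⟨c, hc⟩ := oneCocycleClass_surjective (quotConjTopRep φ A H htriv) (Multiplicative.toAdd y)
  have hy' : Multiplicative.ofAdd (oneCocycleClass _ c) = y := by rw [hc, ofAdd_toAdd]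
  subst hy'
  have h1 := congrArg (ContH1.toContinuousCohomology φ A H) hy
  rw [ContH1.toContinuousCohomology_inflOfQuotient, toAdd_ofAdd, map_oneCocycleClass, map_one,
    ← ofAdd_zero, Multiplicative.ofAdd.apply_eq_iff_eq, oneCocycleClass_eq_zero_iff] at h1
  obtain ⟨v, hv⟩ := h1
  rw [← ofAdd_zero, Multiplicative.ofAdd.apply_eq_iff_eq, oneCocycleClass_eq_zero_iff]
  refine ⟨v, fun q => ?_⟩
  induction q using QuotientGroup.induction_on with
  | H h => exact hv h

include hφ in
/-- `res ∘ infl`-exactness, read in `ContH1`: **the range of inflation from `H/N` is the kernel of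
restriction to `N`** (`N ⊴ H` acting trivially on `A`).
[cite: NeukirchSchmidtWingberg2008, I §2 and II §7] -/
theorem ContH1.range_inflOfQuotient_eq_ker_res :
    (ContH1.inflOfQuotient φ A H htriv).range = (ContH1.res φ A hNH).ker := by
  have hexact := ContinuousCohomology.exact_inf_res_one (k := ℤ) (N.subgroupOf H)
    (X := conjTopRep φ A H) (Y := conjTopRep φ A N)
    (quotResHom φ A H htriv) (inclusionₜ hNH) (resHom φ A hNH)
    (fun _ _ h => h) Topology.IsInducing.id
    (fun m _ => ⟨m, rfl⟩)
    (fun n => Subgroup.mem_subgroupOf.2 (by simp))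
    (fun s hs => ⟨⟨(s : G), Subgroup.mem_subgroupOf.1 hs⟩, Subtype.ext rfl⟩)
    Function.bijective_id
    (fun m => by
      change Continuous fun g : H =>
        Additive.ofMul (α := A) (MulAut.conjNormal (φ (g : G)) (Additive.toMul (α := A) m))
      refine continuous_ofMul.comp (continuous_induced_rng.2 ?_)
      have hc : Continuous fun g : H => φ (g : G) := hφ.comp continuous_subtype_val
      change Continuous fun g : H => φ (g : G) * ((Additive.toMul (α := A) m : A) : G') * (φ (g : G))⁻¹
      exact (hc.mul continuous_const).mul hc.inv)
  ext x
  constructor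
  · rintro ⟨y, rfl⟩
    rw [MonoidHom.mem_ker]
    apply ContH1.toContinuousCohomology_injective φ A N
    rw [ContH1.toContinuousCohomology_res, ContH1.toContinuousCohomology_inflOfQuotient, toAdd_ofAdd,
      map_one, ← ofAdd_zero]
    congr 1
    exact (hexact _).2 ⟨Multiplicative.toAdd y, rfl⟩
  · intro hx
    rw [MonoidHom.mem_ker] at hx
    have h0 : (ContinuousCohomology.map (inclusionₜ hNH) (resHom φ A hNH) 1).hom
        (Multiplicative.toAdd (ContH1.toContinuousCohomology φ A H x)) = 0 := by
      have h := ContH1.toContinuousCohomology_res φ A hNH x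
      rw [hx, map_one] at h
      have h' := congrArg Multiplicative.toAdd h
      rw [toAdd_one, toAdd_ofAdd] at h'
      exact h'.symm
    obtain ⟨z, hz⟩ := (hexact _).1 h0
    refine ⟨Multiplicative.ofAdd z, ?_⟩
    apply ContH1.toContinuousCohomology_injective φ A H
    rw [ContH1.toContinuousCohomology_inflOfQuotient, toAdd_ofAdd, hz, ofAdd_toAdd]

/-- **`Ker(H¹(H, A) → H¹(N, A)) ≅ H¹(H/N, A)`** for `N ⊴ H` acting trivially on `A` — the degree-one
inflation–restriction sequence as a group isomorphism onto the kernel of `ContH1.res`.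
[cite: NeukirchSchmidtWingberg2008, I §2 and II §7] -/
def ContH1.kerResEquivQuotient :
    Multiplicative (continuousCohomology 1 (quotConjTopRep φ A H htriv)) ≃* (ContH1.res φ A hNH).ker :=
  (MonoidHom.ofInjective (ContH1.inflOfQuotient_injective φ A H htriv)).trans
    (MulEquiv.subgroupCongr (ContH1.range_inflOfQuotient_eq_ker_res φ A H hNH htriv hφ))

/-- The isomorphism is inflation. [cite: NeukirchSchmidtWingberg2008, I §2 and II §7] -/
@[simp] theorem ContH1.coe_kerResEquivQuotient_apply
    (y : Multiplicative (continuousCohomology 1 (quotConjTopRep φ A H htriv))) :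
    ((ContH1.kerResEquivQuotient φ A H hNH htriv hφ y : (ContH1.res φ A hNH).ker) : ContH1 φ A H) =
      ContH1.inflOfQuotient φ A H htriv y := rfl

include hφ in
/-- A class of `ContH1 φ A H` killed by restriction to `N` is inflated from a UNIQUE class of
`H¹(H/N, A)`. [cite: NeukirchSchmidtWingberg2008, I §2 and II §7] -/
theorem ContH1.existsUnique_inflOfQuotient_of_res_eq_one (x : ContH1 φ A H)
    (hx : ContH1.res φ A hNH x = 1) :
    ∃! y : Multiplicative (continuousCohomology 1 (quotConjTopRep φ A H htriv)),
      ContH1.inflOfQuotient φ A H htriv y = x := by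
  have hx' : x ∈ (ContH1.inflOfQuotient φ A H htriv).range := by
    rw [ContH1.range_inflOfQuotient_eq_ker_res φ A H hNH htriv hφ]
    exact hx
  obtain ⟨y, rfl⟩ := hx'
  exact ⟨y, rfl, fun y' hy' => ContH1.inflOfQuotient_injective φ A H htriv hy'⟩

end InfRes

end Literature.AnabelianGeometry.EtaleTheta
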